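import Mathlib
import HarnessLib
import Literature.RingTheory.TightClosure.TightClosure
import Summits.ResolutionOfSingularities.ResolutionOfSingularities.Theorems.FrobeniusLadderFInjectiveMacaulayficationStubPigeonhole

/-!
# Trapped Cartier image (crux `FrobeniusLadder.FInjectiveMacaulayfication`, line `Sketch`, stub `stub_trapped_image`)

Stub `stub_trapped_image` of the skeleton `Sketch` for crux stmt-ResolutionOfSingularities-15315
(card `graded-cartier-criterion`). Let `R` be a commutative ring, `p` a prime, and `T : R →+ R` an
additive map that is `p⁻¹`-linear, `T (r ^ p * s) = r * T s` (an abstract Cartier trace). If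
`𝔞 = (g₀, …, g_{ν-1})` is generated by `ν` elements, then
`(T(𝔞 ^ (p n + (ν - 1) (p - 1)))) ≤ 𝔞 ^ n * (T(R))`:
the Cartier image of a high power of a centre with few generators is trapped in `𝔞 ^ n`.

Proof: by the PIGEONHOLE stub (`stub_pigeonhole`, landed),
`𝔞 ^ (p n + (ν - 1) (p - 1)) ≤ (𝔞 ^ n)^[p] = Ideal.span {z ^ p | z ∈ 𝔞 ^ n}`, and by
`p⁻¹`-linearity `T (Σ rᵢ zᵢ ^ p) = Σ zᵢ T rᵢ ∈ 𝔞 ^ n * (T(R))` (`span_image_frobeniusPower_le`,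
a `Submodule.span_induction` with the predicate strengthened to `∀ r, T (r * w) ∈ 𝔞 ^ n * (T(R))`
since `T` is only additive). Pure commutative algebra over Mathlib; no characteristic assumption.
-/

-- single-problem summit: the doubled namespace component is forced
set_option linter.dupNamespace false

namespace Summit.ResolutionOfSingularities.ResolutionOfSingularities.Theorems.FInjectiveMacaulayfication

open Literature.RingTheory.TightClosure

/-- `p⁻¹`-linearity traps the image of a Frobenius bracket power: for an additive `T : R →+ R` with
`T (r ^ p * s) = r * T s` and any ideal `K`, `(T(K^[p])) ≤ K * (T(R))`. Indeed an element of
`K^[p] = Ideal.span {z ^ p | z ∈ K}` is `w = Σ rᵢ zᵢ ^ p` with `zᵢ ∈ K`, and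
`T (r * w) = Σ zᵢ T (r rᵢ) ∈ K * (T(R))` for every `r` (span induction on `w`). -/
theorem span_image_frobeniusPower_le {R : Type} [CommRing R] (p : ℕ) (T : R →+ R)
    (hT : ∀ r s : R, T (r ^ p * s) = r * T s) (K : Ideal R) :
    Ideal.span (T '' ↑(frobeniusPower p K)) ≤ K * Ideal.span (Set.range T) := by
  refine Ideal.span_le.mpr ?_
  rintro _ ⟨w, hw, rfl⟩
  rw [SetLike.mem_coe, frobeniusPower_def] at hw
  rw [SetLike.mem_coe]
  suffices h : ∀ r : R, T (r * w) ∈ K * Ideal.span (Set.range T) by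
    simpa only [one_mul] using h 1
  induction hw using Submodule.span_induction with
  | mem x hx =>
    intro r
    obtain ⟨z, hz, rfl⟩ := hx
    show T (r * z ^ p) ∈ K * Ideal.span (Set.range T)
    rw [mul_comm r, hT]
    exact Ideal.mul_mem_mul hz (Ideal.subset_span ⟨r, rfl⟩)
  | zero =>
    intro r
    rw [mul_zero, map_zero]
    exact Submodule.zero_mem _
  | add x y _ _ hx hy =>
    intro r
    rw [mul_add, map_add]
    exact Submodule.add_mem _ (hx r) (hy r)
  | smul c x _ hx =>
    intro r
    rw [smul_eq_mul, ← mul_assoc]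
    exact hx (r * c)

/-- TRAPPED IMAGE (card `graded-cartier-criterion`, Sketch `stub_trapped_image`): with `T : R →+ R`
additive and `p⁻¹`-linear (`T (r ^ p * s) = r * T s`) and `𝔞 = (g₀, …, g_{ν-1})`,
`(T(𝔞 ^ (p n + (ν - 1) (p - 1)))) ≤ 𝔞 ^ n * (T(R))` — pigeonhole
(`stub_pigeonhole`: `𝔞 ^ (p n + (ν - 1) (p - 1)) ≤ (𝔞 ^ n)^[p]`), then
`T (Σ rᵢ zᵢ ^ p) = Σ zᵢ T rᵢ` (`span_image_frobeniusPower_le`). -/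
theorem stub_trapped_image : ∀ {R : Type} [CommRing R] (p : ℕ), p.Prime → ∀ (T : R →+ R),
    (∀ r s : R, T (r ^ p * s) = r * T s) → ∀ {ν : ℕ} (g : Fin ν → R) (n : ℕ),
      Ideal.span (T '' ↑(Ideal.span (Set.range g) ^ (p * n + (ν - 1) * (p - 1)))) ≤
        Ideal.span (Set.range g) ^ n * Ideal.span (Set.range T) := by
  intro R _ p hp T hT ν g n
  exact (Ideal.span_mono (Set.image_mono (stub_pigeonhole p hp g n))).trans
    (span_image_frobeniusPower_le p T hT _)

end Summit.ResolutionOfSingularities.ResolutionOfSingularities.Theorems.FInjectiveMacaulayfication
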